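import Mathlib.NumberTheory.Padics.PadicVal.Basic
import Literature.Barriers.ABC.BakerMethodBoundsStewartYuProofs
import Literature.NumberTheory.DiophantineGeometry.AbcWave0QualityFormProofs
import Summits.ABC.ABC.Theorems.RibetTakahashiSplitFewPrimeValuationProductStubDecisivePrimeBootstrapLemmas
import Summits.ABC.ABC.Theorems.RibetTakahashiSplitFewPrimeValuationProductStubDecisivePrimeBootstrapShape

/-!
# The decisive-prime bootstrap, III: the stub `stub_decisivePrimeBootstrap`

Support file (`--supports`) for the crux
`Summit.ABC.ABC.Theses.RibetTakahashiSplit.FewPrimeValuationProduct` (stmt-ABC-1563), line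
`matveev-face-clearing`: the registered stub `stub_decisivePrimeBootstrap` (the decisive-prime
bootstrap in the balanced hard core), proved from the statements of the line's stub 1 (Matveev + Yu
over `ℚ` in Pasten's form, `∃ K ≥ 1, Dioph.PastenApproximationBound K`) and stub 5 (the
two-logarithm one-prime depth bound `TwoLogOnePrime(η)`), both taken as hypotheses.

Route of the proof (`R = rad(abc)`, `Λ = max(log R, 1)`, `Y = log max{e, 2 log c}`):
1. shape `{a, b, c} = {2^i ℓ^e, 2^j P^X, 2^m Q^Z}` and `∏ v_p(abc) = (i+j+m) e X Z`
   (`…StubDecisivePrimeBootstrapShape`);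
2. `Y ≤ C_Y Λ` from Stewart–Yu's `log c ≤ κ R^{1/3} (log R)³`
   (`Literature.Barriers.ABC.bakerShapeBound_third_three_of_approximationBound`);
3. (B2) `i, j, m ≤ 9 K⁵ C_Y Λ⁵` from the `2`-adic clause (`Pasten.padic_bound_a/c`) and
   `Θ ≤ K⁵ Λ⁴`; (B1) `log c − log a < K⁵ Λ⁴ Y` from the archimedean clause (`Pasten.arch_bound`);
4. `log a ≤ k + e Λ`, `B = max(X, Z) ≤ log c` (`3^B ≤ c`);
5. `e = v_ℓ(a)` is the `ℓ`-adic depth of `P^X ∓ 2^{k'} Q^Z`: either `e < ℓ^{ε'} ≤ R^{ε'}` or the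
   depth hypothesis bounds it, `ε' = ε min(η,1)/8`;
6. the bootstrap algebra `decisivePrimeBootstrap_real` (`…StubDecisivePrimeBootstrapLemmas`).
The balance hypothesis of the stub (every odd prime `> rad^ε`) is not used.
-/

-- `Summit.ABC.ABC` is the mandated summit-side namespace (CONVENTIONS §2); the duplicate is
-- deliberate.
set_option linter.dupNamespace false

namespace Summit.ABC.ABC.Theorems.FewPrimeValuationProduct

open Finset Real
open Literature.NumberTheory.DiophantineGeometry
open Literature.NumberTheory.DiophantineGeometry.Dioph
open Literature.NumberTheory.DiophantineGeometry.Pasten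

/-! ## The stub -/

/-- **Stub `stub_decisivePrimeBootstrap` of the line `matveev-face-clearing` (the decisive-prime
bootstrap, balanced hard core).** Assume (1) Matveev + Yu over `ℚ` in Pasten's form
(`∃ K ≥ 1, PastenApproximationBound K`) and (2) the two-logarithm one-prime depth bound
`TwoLogOnePrime(η)`. Then for every `ε > 0` there is `C` such that every abc triple on `≤ 4` primes,
no member of which is a power of two, satisfies `∏_{p ∣ abc} v_p(abc) ≤ C · rad(abc)^ε`.
Proof: the triple is `{a, b, c} = {2^i ℓ^e, 2^j P^X, 2^m Q^Z}` (one of `i, j, m` positive, `= k`),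
the product is `k·e·X·Z`; (B2) `k ≪ (log rad)⁵` from the `2`-adic clause, (B1)
`log c − log a ≪ (log rad)⁵` from the archimedean clause, `log c ≪ rad^{1/3}(log rad)³` a priori
(Stewart–Yu); `e = ord_ℓ(P^X ∓ 2^{k'} Q^Z)` is the depth of hypothesis (2), and either `e < ℓ^{ε'}`
or (2) bounds `e` with a power saving in `B = max(X, Z) ≤ log c`, which closes the bootstrap
`B^{η} ≪ rad^{ε'} polylog`. (The balance hypothesis "every odd prime exceeds `rad^ε`" is not
needed.)
`[folklore]` -/
theorem stub_decisivePrimeBootstrap :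
    (∃ K : ℝ, 1 ≤ K ∧ Literature.NumberTheory.DiophantineGeometry.Dioph.PastenApproximationBound K) →
    (∃ η : ℝ, 0 < η ∧ ∀ ε : ℝ, 0 < ε → ∃ (A : ℕ) (C : ℝ), ∀ ℓ p q : ℕ, ℓ.Prime → p.Prime → q.Prime →
      ℓ ≠ 2 → p ≠ 2 → q ≠ 2 → ℓ ≠ p → ℓ ≠ q → p ≠ q →
      ∀ x y k : ℕ, 1 ≤ x → 1 ≤ y → ∀ σ : ℤ, (σ = 1 ∨ σ = -1) →
        (ℓ : ℝ) ^ ε ≤ (padicValInt ℓ ((p : ℤ) ^ x + σ * 2 ^ k * (q : ℤ) ^ y) : ℝ) →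
        (padicValInt ℓ ((p : ℤ) ^ x + σ * 2 ^ k * (q : ℤ) ^ y) : ℝ) ≤
          C * (ℓ : ℝ) ^ ε * (Real.log p * Real.log q * (k + 1)) ^ A * ((max x y : ℕ) : ℝ) ^ (1 - η)) →
    ∀ ε : ℝ, 0 < ε → ∃ C : ℝ, ∀ a b c : ℕ, Literature.NumberTheory.DiophantineGeometry.IsABCTriple a b c →
      (a * b * c).primeFactors.card ≤ 4 →
      ¬ ((∃ j : ℕ, a = 2 ^ j) ∨ (∃ j : ℕ, b = 2 ^ j) ∨ (∃ j : ℕ, c = 2 ^ j)) →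
      (∀ p ∈ (a * b * c).primeFactors, p ≠ 2 →
        (Literature.NumberTheory.DiophantineGeometry.rad a b c : ℝ) ^ ε < p) →
      ((∏ p ∈ (a * b * c).primeFactors, (a * b * c).factorization p : ℕ) : ℝ) ≤
        C * (Literature.NumberTheory.DiophantineGeometry.rad a b c : ℝ) ^ ε := by
  rintro ⟨K, hK, hP⟩ ⟨η, hη, hT⟩ ε hε
  /- Step 0: the constants (depending on `K, κ, η, ε, A, C_T` only). -/
  set η₀ : ℝ := min η 1 with hη₀def
  have hη₀0 : 0 < η₀ := lt_min hη one_pos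
  have hη₀1 : η₀ ≤ 1 := min_le_right _ _
  have hη₀η : η₀ ≤ η := min_le_left _ _
  set ε' : ℝ := ε * η₀ / 8 with hε'def
  have hε'0 : 0 < ε' := by positivity
  obtain ⟨A, CT, hAT⟩ := hT ε' hε'0
  obtain ⟨κ, hκ⟩ := Literature.Barriers.ABC.bakerShapeBound_third_three_of_approximationBound hK hP
  set CY : ℝ := 5 + Real.log (2 * max κ 1) with hCYdef
  have hCY0 : 0 ≤ CY := by
    have : 0 ≤ Real.log (2 * max κ 1) := Real.log_nonneg (by linarith [le_max_right κ 1])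
    rw [hCYdef]; linarith
  have hK0 : 0 ≤ K := zero_le_one.trans hK
  set Ck : ℝ := 3 * (9 * K ^ 5 * CY) with hCkdef
  have hCk0 : 0 ≤ Ck := by positivity
  set Φ : ℝ := K ^ 5 * CY with hΦdef
  have hΦ0 : 0 ≤ Φ := by positivity
  have hCT0 : 0 ≤ max CT 1 := zero_le_one.trans (le_max_right _ _)
  set C₇ : ℝ := max CT 1 * (Ck + 1) ^ A with hC₇def
  have hC₇0 : 0 ≤ C₇ := mul_nonneg hCT0 (by positivity)
  obtain ⟨C, hC⟩ := decisivePrimeBootstrap_real (A := A) hε hη₀0 hη₀1 hCk0 hΦ0 hC₇0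
  refine ⟨C, ?_⟩
  intro a b c habc hcard hface _hbal
  /- Step 1: the shape `{a, b, c} = {2^i ℓ^e, 2^j P^X, 2^m Q^Z}`. -/
  obtain ⟨ℓ, P, Q, hℓ, hPp, hQp, hℓ2, hP2, hQ2, hℓP, hℓQ, hPQ, hℓa, hPb, hQc, hpf⟩ :=
    decisivePrimeBootstrap_shape habc hcard hface
  obtain ⟨ha, hb, hsum, hcop⟩ := id habc
  have hac : a.Coprime c := coprime_left_of_isABCTriple habc
  have hbc : b.Coprime c := coprime_right_of_isABCTriple habc
  have hℓb : ¬ ℓ ∣ b := decisivePrimeBootstrap_not_dvd_of_coprime hℓ hcop hℓa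
  have hℓc : ¬ ℓ ∣ c := decisivePrimeBootstrap_not_dvd_of_coprime hℓ hac hℓa
  have hPa : ¬ P ∣ a := decisivePrimeBootstrap_not_dvd_of_coprime hPp hcop.symm hPb
  have hPc : ¬ P ∣ c := decisivePrimeBootstrap_not_dvd_of_coprime hPp hbc hPb
  have hQa : ¬ Q ∣ a := decisivePrimeBootstrap_not_dvd_of_coprime hQp hac.symm hQc
  have hQb : ¬ Q ∣ b := decisivePrimeBootstrap_not_dvd_of_coprime hQp hbc.symm hQc
  have hc : 0 < c := by omega
  have h0 : a * b * c ≠ 0 := by positivity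
  have hmem : ∀ q ∈ (a * b * c).primeFactors, q = 2 ∨ q = ℓ ∨ q = P ∨ q = Q := by
    intro q hq
    rw [hpf] at hq
    simpa only [Finset.mem_insert, Finset.mem_singleton] using hq
  have hrepa : a = 2 ^ a.factorization 2 * ℓ ^ a.factorization ℓ :=
    decisivePrimeBootstrap_member_eq ha.ne' h0 ⟨b * c, by ring⟩ (Ne.symm hℓ2) hmem hPa hQa
  have hrepb : b = 2 ^ b.factorization 2 * P ^ b.factorization P :=
    decisivePrimeBootstrap_member_eq hb.ne' h0 ⟨a * c, by ring⟩ (Ne.symm hP2)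
      (fun q hq => by rcases hmem q hq with h | h | h | h <;> omega) hℓb hQb
  have hrepc : c = 2 ^ c.factorization 2 * Q ^ c.factorization Q :=
    decisivePrimeBootstrap_member_eq hc.ne' h0 ⟨a * b, by ring⟩ (Ne.symm hQ2)
      (fun q hq => by rcases hmem q hq with h | h | h | h <;> omega) hℓc hPc
  have hprod := decisivePrimeBootstrap_prod_factorization_eq ha.ne' hb.ne' hc.ne' hpf (Ne.symm hℓ2)
    (Ne.symm hP2) (Ne.symm hQ2) hℓP hℓQ hPQ hℓb hℓc hPa hPc hQa hQb
  have hpv : padicValNat ℓ a = a.factorization ℓ := (Nat.factorization_def a hℓ).symm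
  -- the exponents
  set i : ℕ := a.factorization 2 with hidef
  set j : ℕ := b.factorization 2 with hjdef
  set m : ℕ := c.factorization 2 with hmdef
  set e : ℕ := a.factorization ℓ with hedef
  set X : ℕ := b.factorization P with hXdef
  set Z : ℕ := c.factorization Q with hZdef
  have he1 : 0 < e := hℓ.factorization_pos_of_dvd ha.ne' hℓa
  have hX1 : 0 < X := hPp.factorization_pos_of_dvd hb.ne' hPb
  have hZ1 : 0 < Z := hQp.factorization_pos_of_dvd hc.ne' hQc
  -- `b` and `c` are not both even
  have hjm : j = 0 ∨ m = 0 := by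
    by_contra hne
    rw [not_or] at hne
    exact decisivePrimeBootstrap_not_dvd_of_coprime Nat.prime_two hbc
      (Nat.dvd_of_factorization_pos hne.1) (Nat.dvd_of_factorization_pos hne.2)
  /- Step 2: the real quantities `R`, `Λ`, `Y` and the bounds (Ya), (B1), (B2). -/
  have hR2 : (2 : ℝ) ≤ (rad a b c : ℝ) := by exact_mod_cast habc.two_le_rad
  have hpR : ∀ p : ℕ, p.Prime → p ∣ a * b * c → (p : ℝ) ≤ (rad a b c : ℝ) := fun p hp hpd => by
    exact_mod_cast prime_le_rad hp hpd h0
  set R : ℝ := (rad a b c : ℝ) with hRdef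
  have hR1 : (1 : ℝ) ≤ R := by linarith
  have hR0 : (0 : ℝ) < R := by linarith
  set Λ : ℝ := max (Real.log R) 1 with hΛdef
  have hΛ1 : 1 ≤ Λ := le_max_right _ _
  have hΛ0 : 0 ≤ Λ := zero_le_one.trans hΛ1
  have hlogRΛ : Real.log R ≤ Λ := le_max_left _ _
  have hlogp : ∀ p ∈ (a * b * c).primeFactors, Real.log p ≤ Λ := by
    intro p hp
    have hp' := Nat.prime_of_mem_primeFactors hp
    exact (Real.log_le_log (by exact_mod_cast hp'.pos)
      (hpR p hp' (Nat.dvd_of_mem_primeFactors hp))).trans hlogRΛ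
  have hℓmem : ℓ ∈ (a * b * c).primeFactors := by rw [hpf]; simp
  have hPmem : P ∈ (a * b * c).primeFactors := by rw [hpf]; simp
  have hQmem : Q ∈ (a * b * c).primeFactors := by rw [hpf]; simp
  have hlogℓ : Real.log ℓ ≤ Λ := hlogp ℓ hℓmem
  have hlogP : Real.log P ≤ Λ := hlogp P hPmem
  have hlogQ : Real.log Q ≤ Λ := hlogp Q hQmem
  have hlogP0 : 0 ≤ Real.log P := Real.log_nonneg (by exact_mod_cast hPp.one_lt.le)
  have hlogQ0 : 0 ≤ Real.log Q := Real.log_nonneg (by exact_mod_cast hQp.one_lt.le)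
  -- (Ya): `Y ≤ C_Y Λ`
  set Y : ℝ := Real.log (max (Real.exp 1) (2 * Real.log c)) with hYdef
  have hY1 : 1 ≤ Y := one_le_log_max_exp _
  have hY : Y ≤ CY * Λ := decisivePrimeBootstrap_log_max_le hR1 (hκ a b c habc)
  -- `Θ ≤ K⁵ Λ⁴` for the three coprime pairs
  have hΘ : ∀ u v : ℕ, u ≠ 0 → v ≠ 0 → u.Coprime v → u * v ∣ a * b * c →
      theta K u v 0 ≤ K ^ 5 * Λ ^ 4 := by
    intro u v hu hv huv hdvd
    refine decisivePrimeBootstrap_theta_zero_le hK hΛ1 hu hv huv ?_ ?_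
    · exact (Finset.card_le_card (Nat.primeFactors_mono hdvd h0)).trans hcard
    · exact fun p hp => hlogp p (Nat.primeFactors_mono hdvd h0 hp)
  have hΘbc := hΘ b c hb.ne' hc.ne' hbc ⟨a, by ring⟩
  have hΘac := hΘ a c ha.ne' hc.ne' hac ⟨b, by ring⟩
  have hΘab := hΘ a b ha.ne' hb.ne' hcop ⟨c, by ring⟩
  -- (B1): `log c - log a < K⁵ Λ⁴ Y`
  have hB1 : Real.log c - Real.log a < K ^ 5 * Λ ^ 4 * Y :=
    (arch_bound hK hP habc 0).trans_le (mul_le_mul_of_nonneg_right hΘbc (by linarith))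
  -- (B2): every `2`-exponent is `≤ 9 K⁵ C_Y Λ⁵`
  have hT9 : 0 ≤ 9 * K ^ 5 * CY * Λ ^ 5 := by positivity
  have hia : (i : ℝ) ≤ 9 * K ^ 5 * CY * Λ ^ 5 := by
    by_cases h2a : 2 ∣ a
    · exact decisivePrimeBootstrap_two_adic_numerics (theta_nonneg hK0 b c 0) hΘbc hY1 hY
        (Nat.cast_nonneg _) (padic_bound_a hK hP habc 0 Nat.prime_two h2a)
    · have hi0 : i = 0 := Nat.factorization_eq_zero_of_not_dvd h2a
      rw [hi0, Nat.cast_zero]; exact hT9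
  have hjb : (j : ℝ) ≤ 9 * K ^ 5 * CY * Λ ^ 5 := by
    by_cases h2b : 2 ∣ b
    · exact decisivePrimeBootstrap_two_adic_numerics (theta_nonneg hK0 a c 0) hΘac hY1 hY
        (Nat.cast_nonneg _) (padic_bound_a hK hP habc.swap 0 Nat.prime_two h2b)
    · have hj0 : j = 0 := Nat.factorization_eq_zero_of_not_dvd h2b
      rw [hj0, Nat.cast_zero]; exact hT9
  have hab1 : 1 < a * b := by
    have h2a : 2 ≤ a := le_trans hℓ.two_le (Nat.le_of_dvd ha hℓa)
    have h2b : 2 ≤ b := le_trans hPp.two_le (Nat.le_of_dvd hb hPb)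
    calc 1 < 2 * 2 := by norm_num
      _ ≤ a * b := Nat.mul_le_mul h2a h2b
  have hmc : (m : ℝ) ≤ 9 * K ^ 5 * CY * Λ ^ 5 := by
    by_cases h2c : 2 ∣ c
    · exact decisivePrimeBootstrap_two_adic_numerics (theta_nonneg hK0 a b 0) hΘab hY1 hY
        (Nat.cast_nonneg _) (padic_bound_c hK hP habc hab1 0 Nat.prime_two h2c)
    · have hm0 : m = 0 := Nat.factorization_eq_zero_of_not_dvd h2c
      rw [hm0, Nat.cast_zero]; exact hT9
  set k : ℕ := i + j + m with hkdef
  have hkcast : (k : ℝ) = i + j + m := by rw [hkdef]; push_cast; ring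
  have hk : (k : ℝ) ≤ Ck * Λ ^ 5 := by rw [hkcast, hCkdef]; linarith
  have hi0 : (0 : ℝ) ≤ i := Nat.cast_nonneg _
  have hj0 : (0 : ℝ) ≤ j := Nat.cast_nonneg _
  have hm0 : (0 : ℝ) ≤ m := Nat.cast_nonneg _
  have hjk : (j : ℝ) ≤ k := by rw [hkcast]; linarith
  have hmk : (m : ℝ) ≤ k := by rw [hkcast]; linarith
  -- `log a ≤ k + e Λ`, hence `log c ≤ k + e Λ + Φ Λ⁵`
  have hloga : Real.log a ≤ k + e * Λ := by
    have hcast : (a : ℝ) = (2 : ℝ) ^ i * (ℓ : ℝ) ^ e := by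
      have h := congrArg (Nat.cast : ℕ → ℝ) hrepa
      push_cast at h
      exact h
    have hℓ0 : (0 : ℝ) < ℓ := by exact_mod_cast hℓ.pos
    have hlog2 : Real.log 2 ≤ 1 := by have := Real.log_two_lt_d9; linarith
    rw [hcast, Real.log_mul (by positivity) (by positivity), Real.log_pow, Real.log_pow]
    have t1 : (i : ℝ) * Real.log 2 ≤ k := by
      have : (i : ℝ) * Real.log 2 ≤ i := mul_le_of_le_one_right hi0 hlog2
      rw [hkcast]; linarith
    have t2 : (e : ℝ) * Real.log ℓ ≤ e * Λ := mul_le_mul_of_nonneg_left hlogℓ (Nat.cast_nonneg _)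
    linarith
  have hy : Real.log c ≤ k + e * Λ + Φ * Λ ^ 5 := by
    have : K ^ 5 * Λ ^ 4 * Y ≤ Φ * Λ ^ 5 := by
      calc K ^ 5 * Λ ^ 4 * Y ≤ K ^ 5 * Λ ^ 4 * (CY * Λ) :=
            mul_le_mul_of_nonneg_left hY (by positivity)
        _ = Φ * Λ ^ 5 := by rw [hΦdef]; ring
    linarith
  -- `B = max(X, Z)`, `3^B ≤ c`, so `B ≤ log c`
  set B : ℕ := max X Z with hBdef
  have hXB : X ≤ B := le_max_left _ _
  have hZB : Z ≤ B := le_max_right _ _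
  have hB1 : (1 : ℝ) ≤ (B : ℝ) := by
    exact_mod_cast (Nat.one_le_iff_ne_zero.mpr hX1.ne').trans hXB
  have h3B : 3 ^ B ≤ c := by
    have hPX : P ^ X ≤ b := Nat.ordProj_le P hb.ne'
    have hQZ : Q ^ Z ≤ c := Nat.ordProj_le Q hc.ne'
    have h3P : 3 ≤ P := by have := hPp.two_le; omega
    have h3Q : 3 ≤ Q := by have := hQp.two_le; omega
    have hbc' : b ≤ c := by omega
    rcases le_total X Z with hXZ | hZX
    · rw [hBdef, max_eq_right hXZ]; exact (Nat.pow_le_pow_left h3Q Z).trans hQZ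
    · rw [hBdef, max_eq_left hZX]; exact ((Nat.pow_le_pow_left h3P X).trans hPX).trans hbc'
  have hBy : (B : ℝ) ≤ Real.log c := by
    have h3 : (3 : ℝ) ^ B ≤ c := by exact_mod_cast h3B
    have hlog3 : 1 ≤ Real.log 3 := by
      rw [← Real.log_exp 1]
      exact Real.log_le_log (Real.exp_pos 1) (by have := Real.exp_one_lt_d9; linarith)
    have h4 := Real.log_le_log (by positivity) h3
    rw [Real.log_pow] at h4
    calc (B : ℝ) = B * 1 := (mul_one _).symm
      _ ≤ B * Real.log 3 := mul_le_mul_of_nonneg_left hlog3 (Nat.cast_nonneg _)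
      _ ≤ Real.log c := h4
  /- Step 3: the dichotomy `e < ℓ^{ε'}` / hypothesis (2) at the prime `ℓ` of `a`. -/
  have hℓR : (ℓ : ℝ) ^ ε' ≤ R ^ ε' :=
    Real.rpow_le_rpow (Nat.cast_nonneg _) (hpR ℓ hℓ (Nat.dvd_of_mem_primeFactors hℓmem)) hε'0.le
  have hℓε0 : 0 ≤ (ℓ : ℝ) ^ ε' := Real.rpow_nonneg (Nat.cast_nonneg _) _
  have hBη : ∀ {x y : ℕ}, max x y = B → ((max x y : ℕ) : ℝ) ^ (1 - η) ≤ (B : ℝ) ^ (1 - η₀) := by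
    intro x y hxy
    rw [hxy]
    exact Real.rpow_le_rpow_of_exponent_le hB1 (by linarith)
  have hBη0 : ∀ x y : ℕ, 0 ≤ ((max x y : ℕ) : ℝ) ^ (1 - η) := fun x y =>
    Real.rpow_nonneg (Nat.cast_nonneg _) _
  have hΛQP : Real.log Q * Real.log P ≤ Λ ^ 2 := by
    rw [pow_two]; exact mul_le_mul hlogQ hlogP hlogP0 hΛ0
  have hΛPQ : Real.log P * Real.log Q ≤ Λ ^ 2 := by
    rw [pow_two]; exact mul_le_mul hlogP hlogQ hlogQ0 hΛ0
  have hdich : (e : ℝ) ≤ R ^ ε' ∨ (e : ℝ) ≤ C₇ * R ^ ε' * Λ ^ (7 * A) * (B : ℝ) ^ (1 - η₀) := by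
    by_cases hcase : (ℓ : ℝ) ^ ε' ≤ (e : ℝ)
    · right
      rcases decisivePrimeBootstrap_key_identity hsum hrepb hrepc hjm ℓ with
        ⟨σ, hσ, hval⟩ | ⟨σ, hσ, hval⟩
      · -- `a = Q^Z + σ 2^j P^X`: hypothesis (2) at `(ℓ, Q, P, Z, X, j)`
        rw [hpv] at hval
        have happ := hAT ℓ Q P hℓ hQp hPp hℓ2 hQ2 hP2 hℓQ hℓP hPQ.symm Z X j
          (Nat.one_le_iff_ne_zero.mpr hZ1.ne') (Nat.one_le_iff_ne_zero.mpr hX1.ne') σ hσ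
        rw [hval] at happ
        exact decisivePrimeBootstrap_depth_numerics (happ hcase) hℓR hℓε0 (mul_nonneg hlogQ0 hlogP0)
          hΛQP hj0 hjk hk hCk0 hΛ1 (hBη0 Z X) (hBη (max_comm Z X))
      · -- `-a = P^X + σ 2^m Q^Z`: hypothesis (2) at `(ℓ, P, Q, X, Z, m)`
        rw [hpv] at hval
        have happ := hAT ℓ P Q hℓ hPp hQp hℓ2 hP2 hQ2 hℓP hℓQ hPQ X Z m
          (Nat.one_le_iff_ne_zero.mpr hX1.ne') (Nat.one_le_iff_ne_zero.mpr hZ1.ne') σ hσ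
        rw [hval] at happ
        exact decisivePrimeBootstrap_depth_numerics (happ hcase) hℓR hℓε0 (mul_nonneg hlogP0 hlogQ0)
          hΛPQ hm0 hmk hk hCk0 hΛ1 (hBη0 X Z) (hBη rfl)
    · left
      push Not at hcase
      exact hcase.le.trans hℓR
  /- Step 4: the bootstrap algebra and the conclusion. -/
  have key := hC R Λ (R ^ ε') k e B (Real.log c) rfl rfl hR1 (Nat.cast_nonneg _)
    (Nat.cast_nonneg _) hB1 hy hk hBy hdich
  have hfinal : (((i + j + m) * e * X * Z : ℕ) : ℝ) ≤ (k : ℝ) * e * (B : ℝ) ^ 2 := by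
    rw [hkcast]
    push_cast
    have hXB' : (X : ℝ) ≤ B := by exact_mod_cast hXB
    have hZB' : (Z : ℝ) ≤ B := by exact_mod_cast hZB
    have h0' : (0 : ℝ) ≤ ((i : ℝ) + j + m) * e := by positivity
    calc ((i : ℝ) + j + m) * e * X * Z = ((i : ℝ) + j + m) * e * (X * Z) := by ring
      _ ≤ ((i : ℝ) + j + m) * e * (B * B) :=
          mul_le_mul_of_nonneg_left
            (mul_le_mul hXB' hZB' (Nat.cast_nonneg _) (Nat.cast_nonneg _)) h0'
      _ = ((i : ℝ) + j + m) * e * (B : ℝ) ^ 2 := by ring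
  calc ((∏ p ∈ (a * b * c).primeFactors, (a * b * c).factorization p : ℕ) : ℝ)
      = (((i + j + m) * e * X * Z : ℕ) : ℝ) := by rw [hprod]
    _ ≤ (k : ℝ) * e * (B : ℝ) ^ 2 := hfinal
    _ ≤ C * R ^ ε := key

end Summit.ABC.ABC.Theorems.FewPrimeValuationProduct
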